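import Mathlib
import Literature.MathematicalPhysics.StatisticalMechanics.BarlowStacking
import Literature.MathematicalPhysics.StatisticalMechanics.Crystallization
import Literature.Geometry.DiscreteGeometry.TwoShellPatterns

/-!
# R⋆ «DiscreteBarlowRigidity» — DEF-FREE EXPANDED TEXT (decomp-a2c lens-3 g20; critic row 341 (5); TEXT OF RECORD for R⋆ per critic row 353,
# landed by prover hand 1 (g7) from HOME/decomp-a2c-lens-3/g20/DiscreteBarlowRigidityExpanded.lean be4e4e7c… — body byte-identical, namespace = this module)

The lineage's shared missing lemma, typed over TREE declarations only (Literature `IsTwoShellGoodSet`, `IsHaggSeq`, `triangularVec₁/₂`,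
`haggLabel`, `barlowOffset`, `layerNormal`, `lennardJones`, `PeriodicConfiguration.energyPerParticle`; Mathlib `Set.ncard`, `finsum`,
`Measure.count`), so that it can be REGISTERED as an item / skeleton stub and cited BY NAME by every leaf that needs it
(C 30303 · N 26636 · RDEF 31280 · REP/N 27568/27543 · G 27542).  `Theorems/ChartedPlanarOrderRigidityDoor.lean` (companion landing) proves
`DiscreteBarlowRigidity ↔` this text by `Iff.rfl` (`discreteBarlowRigidity_iff_expanded`) (see `bc/probes.lean`, probe P0) and the kernels beneath N's open pieces.

Constants: `c, C, r` depend on the hard core `δ` ONLY (e⋆ enters only as the reference level `⨅_Q e(Q)`; no e⋆-dependent constant).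
Informal: for every tolerance 0 < θ ≤ 1/16, every δ-separated S ⊆ ℝ³ and every finite chunk K ⊆ S of (1/16, 9/10, 1)-two-shell-clean atoms,
  c·θ²·#{x ∈ K : x is not θ-matched in S}  ≤  Σ_{x ∈ K} (e_x(S) − e⋆)  +  C·#{x ∈ K : ∃ y ∈ S∖K, dist x y ≤ r},
where «θ-matched at x» = two-way θ-matching of S about x to x + A(flexible-gap layered Barlow template of scale b ∈ [9/10, 1]) on B̄(x,4b)/B̄(x,5b)
(the registered `matchedAt` currency of stmt-26636's skeleton c966ab35) and e_x(S) = ½ Σ_{y ∈ S} V_LJ(‖y − x‖).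
-/

noncomputable section

namespace Summit.AtomisticToContinuum.Crystallization.Theorems.ChartedPlanarOrderDiscreteBarlowRigidity

/-- **R⋆ «DiscreteBarlowRigidity»**, def-free expanded text (see the module docstring). -/
def DiscreteBarlowRigidityExpanded : Prop :=
  ∀ δ : ℝ, 0 < δ → ∃ c : ℝ, 0 < c ∧ ∃ C : ℝ, 0 ≤ C ∧ ∃ r : ℝ, 0 < r ∧ ∀ θ : ℝ, 0 < θ → θ ≤ 1 / 16 → ∀ S : Set (EuclideanSpace ℝ (Fin 3)), (∀ x ∈ S, ∀ y ∈ S, x ≠ y → δ ≤ dist x y) → ∀ K : Set (EuclideanSpace ℝ (Fin 3)), K ⊆ S → K.Finite → (∀ x ∈ K, Literature.Geometry.DiscreteGeometry.IsTwoShellGoodSet (1 / 16) (9 / 10) 1 S x) → c * θ ^ 2 * (Set.ncard {p : EuclideanSpace ℝ (Fin 3) | p ∈ K ∧ ¬ (∃ b : ℝ, 9 / 10 ≤ b ∧ b ≤ 1 ∧ ∃ (A : EuclideanSpace ℝ (Fin 3) →ₗᵢ[ℝ] EuclideanSpace ℝ (Fin 3)) (s : ℤ → ℤ) (z : ℤ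 → ℝ), Literature.MathematicalPhysics.StatisticalMechanics.IsHaggSeq s ∧ (∀ m : ℤ, 39 / 50 * b ≤ z (m + 1) - z m ∧ z (m + 1) - z m ≤ 17 / 20 * b) ∧ z 0 = 0 ∧ (∀ y : EuclideanSpace ℝ (Fin 3), dist y p ≤ 4 * b → ((MeasureTheory.Measure.count : MeasureTheory.Measure (EuclideanSpace ℝ (Fin 3))).restrict S) {y} ≠ 0 → ∃ y' : EuclideanSpace ℝ (Fin 3), y' - p ∈ {p | ∃ m i j : ℤ, p = A (((i : ℝ) • Literature.MathematicalPhysics.StatisticalMechanics.triangularVec₁ b) + ((j : ℝ) • Literature.MathematicalPhysics.StatisticalMechanics.triangularVec₂ b) + ((Literature.MathematicalPhysics.StatisticalMechanics.haggLabel s m : ℝ) • Literature.MathematicalPhysics.StatisticalMechanics.barlowOffset b) + (z m • Literature.MathematicalPhysics.StatisticalMechanics.layerNormal 1))} ∧ dist y y' ≤ θ) ∧ (∀ y' : EuclideanSpace ℝ (Fin 3), y' - p ∈ {p | ∃ m i j : ℤ, p = A (((i : ℝ) • Literature.MathematicalPhysics.StatisticalMechanics.triangularVec₁ b) + ((j :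 ℝ) • Literature.MathematicalPhysics.StatisticalMechanics.triangularVec₂ b) + ((Literature.MathematicalPhysics.StatisticalMechanics.haggLabel s m : ℝ) • Literature.MathematicalPhysics.StatisticalMechanics.barlowOffset b) + (z m • Literature.MathematicalPhysics.StatisticalMechanics.layerNormal 1))} → dist y' p ≤ 5 * b → ∃ y : EuclideanSpace ℝ (Fin 3), ((MeasureTheory.Measure.count : MeasureTheory.Measure (EuclideanSpace ℝ (Fin 3))).restrict S) {y} ≠ 0 ∧ dist y y' ≤ θ))} : ℝ) ≤ (∑ᶠ x ∈ K, ((∫ y, Literature.MathematicalPhysics.StatisticalMechanics.lennardJones ‖y - x‖ ∂((MeasureTheory.Measure.count : MeasureTheory.Measure (EuclideanSpace ℝ (Fin 3))).restrict S)) / 2 - (⨅ Q : Literature.MathematicalPhysics.StatisticalMechanics.PeriodicConfiguration 3, Q.energyPerParticle Literature.MathematicalPhysics.StatisticalMechanics.lennardJones))) + C * (Set.ncard {p : EuclideanSpace ℝ (Fin 3) | p ∈ K ∧ ∃ y : EuclideanSpace ℝ (Fin 3), ((MeasureTheory.Measure.count : MeasureTheory.Measure (EuclideanSpace ℝ (Fin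 3))).restrict S) {y} ≠ 0 ∧ y ∉ K ∧ dist p y ≤ r} : ℝ)

end Summit.AtomisticToContinuum.Crystallization.Theorems.ChartedPlanarOrderDiscreteBarlowRigidity

end
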